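import Summits.KontsevichZagierPeriods.KontsevichZagierPeriods.Theses.SpheresForWalls
import Literature.NumberTheory.Transcendental.SemialgebraicMapsProofs

/-!
# `SpinNormalForm` (stmt-KontsevichZagierPeriods-16456, route SpheresForWalls, crux rank 2) — birth skeleton

Crux (verbatim the route decl `…Theses.SpheresForWalls.SpinNormalForm`, rev 1, P-pinned form): for
every PINNED DISC PADDING `P n r = [{z₀² + z₁² ≤ 1} × σ, f ∘ tail²]` and every integral representation
`r` of dimension `n` there is `N₀` such that for every `N ≥ N₀` the twisted class
`κ^N [r] = (lift (of ∘ P))^[N] (KZ.of r)` is KZ-equivalent to ONE spherical representation `R` of some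
dimension `2m` (`Sph m R`: domain all of `ℝ^{2m}`, density analytic everywhere and again analytic in
each of the `2^m` inversion charts `w_k ↦ w_k / |w_k|²`, Jacobian `|w_k|⁻⁴`). The crux carries `Sph`
and the pinning clause inline (`let Sph := …; ∀ P, (pinning) → …`); below they are NAMED (`Sph`,
`IsDiscPad`, `twist P = lift (of ∘ P)`, literal bodies) and `spinNormalForm_iff` (`Iff.rfl`) certifies
that the names are the crux's bodies (likewise `twistStable_iff` for the route's support item
`TwistStable`).

Line (the route header's own TWO-LAYER PLAN "SpinNormalForm ⇐ ResolvedCellForm → CellSpin", made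
precise; the cell normal form is the CUBE `(0,1)ⁿ` with an integrand analytic on a neighbourhood of the
CLOSED cube, which is exactly what the Archimedes–stereographic spin needs at the two poles of each
sphere; nothing new is filed):

* `stub_cubeNormalForm` — RESOLVED CELL FORM (the content-bearing stub; XL). Every integral
  representation `r` of dimension `n` is congruent modulo `KZ.relations` to a finite sum of GOOD CUBE
  representations of the same dimension: domain the open unit cube `(0,1)ⁿ`, integrand agreeing on it
  with a function real-analytic at every point of the closed cube `[0,1]ⁿ` (`IsGoodCube`). Intended
  proof (moves (1a), (1b), (2) only — all dimension-preserving): compactify (`PeriodCompactify` charts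
  `y ↦ 1/y`); embedded resolution over `ℚ` of the hypersurface carrying `∂σ`, the non-analyticity locus
  of `f`, the discriminant and the leading coefficient of a polynomial `G(x, y)` annihilating `f`
  (tree: `Literature.AlgebraicGeometry.Resolution.exists_logResolution_of_isClosed`, real points via
  `exists_analyticAlgebraicChart`); in SNC coordinates the domain is a union of orthant sectors and, by
  Abhyankar–Jung, `f ∘ π = x^{-γ} · (convergent FRACTIONAL power series)` on each sector; the power
  substitutions `x_i = u_i^L` (Nash diffeos of open sectors) make it `u^ν · ψ(u)` with `ψ` a genuine power
  series, and INTEGRABILITY forces `ν_i + (least u_i-exponent of ψ) ≥ 0` wall by wall, hence every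
  monomial of `u^ν ψ` has non-negative exponents: the integrand × Jacobians is ANALYTIC AT THE CORNER;
  finally cut the compact resolved domain by generic (transverse, rational-level) coordinate slabs of
  finitely many charts into simple curvilinear polytopes, cubulate, and straighten each combinatorial
  cube by the facet-ratio map `t_i = φ_i⁰/(φ_i⁰ + φ_i¹)` (Nash, analytic on a neighbourhood). Null sets
  (lower cells, boundary circles, cut walls) are dropped by move (1a). Why it might fail: the GLOBAL
  cutting/straightening into cubes analytic UP TO THE BOUNDARY (a `C^ω`-up-to-closed-cells cell
  decomposition compatible with the resolved walls; semialgebraic triangulations are only `C¹` up to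
  faces in general — Ohmoto–Shiota) and the real/sectorwise use of Abhyankar–Jung are not in print for
  this calculus; Viu-Sos's semi-canonical reduction (arXiv:1509.01097, Thm 1.1 / Cor 2.2) is the
  nearest printed normal form and goes the other way (compact body, constant integrand, walls kept).
* `stub_cubeSpin` — ARCHIMEDES' HAT-BOX ON A GOOD CUBE (provable now; L). For a pinned padding `P` and
  a good cube `ρ` of dimension `n`, `κⁿ [ρ] = (twist P)^[n] (KZ.of ρ)` is congruent to ONE spherical
  representation of dimension `2n` (`Sph n R`). Proof: `n` times — move the padded disc and the cube
  coordinate `z ∈ (0,1)` together (coordinate permutations are change-of-variables moves, tree: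
  `KZ.of_sub_of_reindex_mem_relations`), kill the disc's second coordinate by one Newton–Leibniz move
  (`[D × (0,1), g] ~ [(−1,1) × (0,1), 2√(1−x²) g]`), and apply the Archimedes–stereographic change of
  variables `(x, z) ↦ w ∈ ℝ²`, `z = |w|²/(1+|w|²)`, `2√(1−x²) dx dz = c d²w/(1+|w|²)²` up to the null
  ray; the resulting density `g(z(w₁), …, z(w_n)) ∏ c/(1+|w_k|²)²` is analytic on `ℝ^{2n}` and in every
  inversion chart (`z ↦ 1 − z`, `(1+|w|²)⁻²|w|⁻⁴ ↦ (1+|w|²)⁻²`) BECAUSE `g` is analytic across `z = 0`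
  and `z = 1`. The route's calibration `UnitIntervalSpin` (stmt-16460) is the case `n = 1`, `g = 1`.
  Why it might fail: only Lean bookkeeping (iterated reindexing along `finProdFinEquiv`, the explicit
  Jacobian); mathematically classical.
* `stub_twistIdeal` — THE TWIST PRESERVES RELATIONS (provable now; M). `c ∈ relations → twist P c ∈
  relations` for every pinned `P`: each of the four moves padded by the disc in front is again a move of
  the same kind. In tree for the PRODUCT form: `KZ.of_mul_mem_relations` / `KZ.piRep_mul_mem_relations`
  (KZProductIdeal.lean, proved); the pinned `P n r : IntegralRep (n + 2)` is the reindexing of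
  `KZ.piRep.prod r : IntegralRep (2 + n)` along `Fin (2 + n) ≃ Fin (n + 2)` (`KZ.IntegralRep.ext'`,
  `KZ.of_sub_of_reindex_mem_relations`), so `twist P c − KZ.of KZ.piRep * c ∈ relations` for all `c` and
  the stub follows. (The route file is import-free by design — rev 1 cone repair — which is why this
  bridge is a stub here and not an import there.) Why it might fail: it should not.
* `stub_twistStable` — literally the route's support item `TwistStable` (stmt-KontsevichZagierPeriods-
  16459; M): one more twist keeps a spherical representation spherical (`[D, 1] ~ [ℝ², (1+|w|²)⁻²]` in
  front, planes shifted). Gives the "`∀ N ≥ N₀`" clause from the "`N = n`" clause.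

Composition `SpinNormalForm_of : stub₁-sig → stub₂-sig → stub₃-sig → stub₄-sig → SpinNormalForm`
(sorry-free; hypotheses spelled through the name-keyed aliases `__Registered.stub_*`): given `P`, `r`,
decompose `[r] ≡ Σ_j [ρ_j]` (S1); push through `κⁿ` (S3: `κ` is additive and preserves relations);
spin each cube, `κⁿ[ρ_j] ≡ [R_j]` with all `R_j` spherical of the SAME dimension `2n` (S2); merge
`Σ_j [R_j] ≡ [R₀]` by integrand additivity on the common domain `ℝ^{2n}` (`exists_sph_sum`, PROVED here:
sums of everywhere-analytic chart densities are analytic, `IsSemialgebraicFunOn.add_holds`); this is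
`N₀ = n`; for `N = n + j` induct on `j` with S4 and S3 (`κ^{N+1}[r] − [R′] = κ(κ^N[r] − [R]) + ([P R] −
[R′])`). `SpinNormalForm_skeleton : SpinNormalForm` feeds the four stubs in.

Disproof used: none on file for this crux (`ledger crux ls stmt-KontsevichZagierPeriods-16456`: no
workfiles, no `Disproof.lean`, no `Theorems/…/Negative/*`); `ledger negatives --problem
KontsevichZagierPeriods`: nothing on spherical / cube normal forms. Item evidence read: grounders g55-1
(NEW; Viu-Sos 1509.01097 = resolution half in print, different target normal form) and g56-0 (in-tree
log resolution, real algebraic charts, CAD, Viu-Sos compactification charts — used in the plan of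
`stub_cubeNormalForm`), refuter route-review ("16456 not cheaply refutable, reduces to
ResolvedCellForm + Archimedes (pole analyticity checked)" — this file types exactly that reduction).
All statements are over existing declarations (`Literature.NumberTheory.Transcendental.KZ.*` of
`KZCalculus`, Mathlib) plus the four literal-body names of this file; provers of a stub
`import Summits.KontsevichZagierPeriods.KontsevichZagierPeriods.Cruxes.SpinNormalForm.Lines.birth` and
`open Summit.KontsevichZagierPeriods.KontsevichZagierPeriods.Cruxes.SpinNormalForm.Birth` for them.
-/

set_option linter.dupNamespace false

namespace Summit.KontsevichZagierPeriods.KontsevichZagierPeriods.Cruxes.SpinNormalForm.Birth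

open scoped BigOperators
open MeasureTheory Set
open Literature.NumberTheory.Transcendental
open Summit.KontsevichZagierPeriods.KontsevichZagierPeriods.Theses.SpheresForWalls (SpinNormalForm TwistStable)

-- BEGIN VOCAB (copied verbatim into the BC3 probe files)
/-! ### The crux's vocabulary, named — literal bodies -/

/-- **Spherical representation of dimension `2m`** (verbatim the `let Sph` of the crux): domain all of
`ℝ^{2m}` and, for every choice `ε` of coordinate planes to invert (`w_k ↦ w_k/|w_k|²`, Jacobian
`|w_k|⁻⁴`), an everywhere-analytic `K` agreeing with the pulled-back density off the inverted planes'
origins — an analytic density on `(S²)^m`. [cite: KontsevichZagier2001, §1.2] -/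
def Sph (m : ℕ) (R : KZ.IntegralRep (m * 2)) : Prop :=
  R.domain = Set.univ ∧ ∀ ε : Fin m → Bool, ∃ K : (Fin (m * 2) → ℝ) → ℝ, (∀ w, AnalyticAt ℝ K w) ∧
    ∀ w : Fin (m * 2) → ℝ, (∀ k : Fin m, ε k = true →
      w (finProdFinEquiv (k, (0 : Fin 2))) ^ 2 + w (finProdFinEquiv (k, (1 : Fin 2))) ^ 2 ≠ 0) →
      K w = R.integrand (fun i : Fin (m * 2) => if ε (finProdFinEquiv.symm i).1 = true then
        w i / (w (finProdFinEquiv ((finProdFinEquiv.symm i).1, (0 : Fin 2))) ^ 2 +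
          w (finProdFinEquiv ((finProdFinEquiv.symm i).1, (1 : Fin 2))) ^ 2) else w i) *
        ∏ k : Fin m, (if ε k = true then ((w (finProdFinEquiv (k, (0 : Fin 2))) ^ 2 +
          w (finProdFinEquiv (k, (1 : Fin 2))) ^ 2)⁻¹) ^ 2 else 1)

/-- **Pinned disc padding** (verbatim the pinning clause of the crux): `P n r` has domain
`{z₀² + z₁² ≤ 1} × σ` and integrand `f ∘ tail²`. [cite: KontsevichZagier2001, §1.2] -/
def IsDiscPad (P : ∀ n : ℕ, KZ.IntegralRep n → KZ.IntegralRep (n + 2)) : Prop :=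
  ∀ (n : ℕ) (r : KZ.IntegralRep n), (P n r).domain = {z : Fin (n + 2) → ℝ | z 0 ^ 2 + z 1 ^ 2 ≤ 1 ∧
    (fun i : Fin n => z i.succ.succ) ∈ r.domain} ∧
    (P n r).integrand = fun z => r.integrand (fun i : Fin n => z i.succ.succ)

/-- **The twist `κ = [π]⋆`** (verbatim the crux's `FreeAbelianGroup.lift (fun s => KZ.of (P s.1 s.2))`):
the additive extension of the padding to formal combinations. [cite: KontsevichZagier2001, §1.2] -/
def twist (P : ∀ n : ℕ, KZ.IntegralRep n → KZ.IntegralRep (n + 2)) : KZ.FormalRep →+ KZ.FormalRep :=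
  FreeAbelianGroup.lift (fun s : (Σ n, KZ.IntegralRep n) => KZ.of (P s.1 s.2))

/-- **Good cube representation** (the cell normal form of this line): domain the open unit cube
`(0,1)ⁿ`, integrand agreeing on it with a function real-analytic at every point of the CLOSED cube
`[0,1]ⁿ` (hence on a neighbourhood of it). [cite: KontsevichZagier2001, §1.2] -/
def IsGoodCube (n : ℕ) (ρ : KZ.IntegralRep n) : Prop :=
  ρ.domain = Set.pi Set.univ (fun _ : Fin n => Set.Ioo (0 : ℝ) 1) ∧
    ∃ g : (Fin n → ℝ) → ℝ, (∀ x ∈ Set.pi Set.univ (fun _ : Fin n => Set.Icc (0 : ℝ) 1), AnalyticAt ℝ g x) ∧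
      Set.EqOn ρ.integrand g ρ.domain

-- END VOCAB

/-- The twist of a generator is the padded generator. [cite: KontsevichZagier2001, §1.2] -/
theorem twist_of (P : ∀ n : ℕ, KZ.IntegralRep n → KZ.IntegralRep (n + 2)) {d : ℕ} (r : KZ.IntegralRep d) :
    twist P (KZ.of r) = KZ.of (P d r) :=
  FreeAbelianGroup.lift_apply_of _ _

/-- **The crux through the named vocabulary** — DEFINITIONAL (`Iff.rfl`): certifies that `Sph`,
`IsDiscPad`, `twist` are literally the crux's `let`-body, pinning clause and twist.
[cite: KontsevichZagier2001, §1.2] -/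
theorem spinNormalForm_iff :
    SpinNormalForm ↔ ∀ P : ∀ n : ℕ, KZ.IntegralRep n → KZ.IntegralRep (n + 2), IsDiscPad P →
      ∀ (n : ℕ) (r : KZ.IntegralRep n), ∃ N₀ : ℕ, ∀ N : ℕ, N₀ ≤ N →
        ∃ (m : ℕ) (R : KZ.IntegralRep (m * 2)), Sph m R ∧
          (⇑(twist P))^[N] (KZ.of r) - KZ.of R ∈ KZ.relations :=
  Iff.rfl

/-- **The route's support item `TwistStable` through the named vocabulary** — DEFINITIONAL
(`Iff.rfl`). [cite: KontsevichZagier2001, §1.2] -/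
theorem twistStable_iff :
    TwistStable ↔ ∀ P : ∀ n : ℕ, KZ.IntegralRep n → KZ.IntegralRep (n + 2), IsDiscPad P →
      ∀ (m : ℕ) (R : KZ.IntegralRep (m * 2)), Sph m R →
        ∃ R' : KZ.IntegralRep ((m + 1) * 2), Sph (m + 1) R' ∧
          KZ.of (P (m * 2) R) - KZ.of R' ∈ KZ.relations :=
  Iff.rfl

/-! ### The four statements of the line (named; each is registered below as a `stub_…`) -/

/-- **(N) Cube normal form** — the statement of `stub_cubeNormalForm`; OPEN (the content).
[cite: KontsevichZagier2001, §1.2] [cite: BochnakCosteRoy1998, §§2, 8, 9] [cite: Hironaka1964] -/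
def CubeNormalForm : Prop :=
  ∀ (n : ℕ) (r : KZ.IntegralRep n), ∃ (k : ℕ) (ρ : Fin k → KZ.IntegralRep n),
    (∀ j, IsGoodCube n (ρ j)) ∧ KZ.of r - ∑ j, KZ.of (ρ j) ∈ KZ.relations

/-- **(S) Cube spin** — the statement of `stub_cubeSpin`; provable now.
[cite: KontsevichZagier2001, §1.2] [cite: DuistermaatHeckman1982] -/
def CubeSpin : Prop :=
  ∀ P : ∀ n : ℕ, KZ.IntegralRep n → KZ.IntegralRep (n + 2), IsDiscPad P →
    ∀ (n : ℕ) (ρ : KZ.IntegralRep n), IsGoodCube n ρ →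
      ∃ R : KZ.IntegralRep (n * 2), Sph n R ∧ (⇑(twist P))^[n] (KZ.of ρ) - KZ.of R ∈ KZ.relations

/-- **(I) Twist ideal** — the statement of `stub_twistIdeal`; provable now (KZProductIdeal bridge).
[cite: KontsevichZagier2001, §1.2] -/
def TwistIdeal : Prop :=
  ∀ P : ∀ n : ℕ, KZ.IntegralRep n → KZ.IntegralRep (n + 2), IsDiscPad P →
    ∀ c ∈ KZ.relations, twist P c ∈ KZ.relations

/-! ### Registered stubs (the only `sorry`s of this file) -/

/-- **STUB S1 — CUBE NORMAL FORM / RESOLVED CELL FORM** (the content-bearing stub; XL; open). Every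
integral representation `r : KZ.IntegralRep n` is congruent modulo `KZ.relations` to a finite sum
`Σ_j [ρ_j]` of GOOD CUBE representations of the same dimension `n` (`IsGoodCube`: domain `(0,1)ⁿ`,
integrand `= g` there with `g` analytic at every point of `[0,1]ⁿ`). Signs are absorbed (`[C, −g]` is a
good cube), multiplicities by repetition; `n = 0`: `r` is a constant on the one-point space (`k = 1`)
or has empty domain (`k = 0`, `[∅, f]` is a relation by (1a)). Plan: compactify → embedded resolution
over `ℚ` of walls + singular/discriminant/leading-coefficient loci → Abhyankar–Jung on sectors → power
substitutions (integrability ⇒ analytic at corners) → generic transverse slab cutting → cubulation of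
simple curvilinear polytopes → facet-ratio straightening; only moves (1a), (1b), (2). Why it might
fail: the global `C^ω`-up-to-the-boundary cubulation compatible with the resolved walls, and the
sectorwise real Abhyankar–Jung step, are unrecorded for this calculus (nearest print: Viu-Sos
arXiv:1509.01097 Thm 1.1, the opposite normal form). [cite: KontsevichZagier2001, §1.2]
[cite: BochnakCosteRoy1998, §§2, 8, 9] [cite: Hironaka1964] [cite: BierstoneMilman1988, Thm 4.4] -/
theorem stub_cubeNormalForm :
    ∀ (n : ℕ) (r : KZ.IntegralRep n), ∃ (k : ℕ) (ρ : Fin k → KZ.IntegralRep n),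
      (∀ j, IsGoodCube n (ρ j)) ∧ KZ.of r - ∑ j, KZ.of (ρ j) ∈ KZ.relations := by
  sorry

/-- **STUB S2 — ARCHIMEDES' HAT-BOX ON A GOOD CUBE** (provable now; L). For every pinned disc padding
`P` and every good cube `ρ` of dimension `n`, the `n`-fold twist `(twist P)^[n] [ρ]` is congruent
modulo `KZ.relations` to a single spherical representation `R` of dimension `2n` (`Sph n R`): per
coordinate, reindex (change of variables by a permutation), one Newton–Leibniz move flattening the
disc to `[(−1,1), 2√(1−x²)]`, and the Archimedes–stereographic change of variables
`(x, z) ↦ w ∈ ℝ²`, `z = |w|²/(1+|w|²)`, onto `ℝ²` minus a null ray (re-added by (1a)); the density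
`g(z(w₁),…,z(w_n)) ∏ c/(1+|w_k|²)²` is analytic on `ℝ^{2n}` and in every inversion chart because `g` is
analytic across `z = 0, 1`. `UnitIntervalSpin` (stmt-16460) is `n = 1, g = 1`. Why it might fail: Lean
bookkeeping only (iterated `finProdFinEquiv` reindexing, explicit Jacobians).
[cite: KontsevichZagier2001, §1.2] [cite: DuistermaatHeckman1982] -/
theorem stub_cubeSpin :
    ∀ P : ∀ n : ℕ, KZ.IntegralRep n → KZ.IntegralRep (n + 2), IsDiscPad P →
      ∀ (n : ℕ) (ρ : KZ.IntegralRep n), IsGoodCube n ρ →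
        ∃ R : KZ.IntegralRep (n * 2), Sph n R ∧
          (⇑(twist P))^[n] (KZ.of ρ) - KZ.of R ∈ KZ.relations := by
  sorry

/-- **STUB S3 — THE TWIST PRESERVES RELATIONS** (provable now; M). For every pinned disc padding `P`,
`c ∈ KZ.relations → twist P c ∈ KZ.relations`: padding a move instance by the disc in front is a move
instance of the same kind (domain additivity: `D × (σ₁ ∪ σ₂)`, null overlap; integrand additivity;
change of variables `id_D × Φ`; Newton–Leibniz over the base `D × τ`). Bridge to the tree: `P n r` is the
reindexing of `KZ.piRep.prod r` along `Fin (2 + n) ≃ Fin (n + 2)` (`KZ.IntegralRep.ext'`,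
`KZ.of_sub_of_reindex_mem_relations`), and `KZ.piRep_mul_mem_relations` (KZProductIdeal.lean, proved)
is the product form. Why it might fail: it should not. [cite: KontsevichZagier2001, §1.2] -/
theorem stub_twistIdeal :
    ∀ P : ∀ n : ℕ, KZ.IntegralRep n → KZ.IntegralRep (n + 2), IsDiscPad P →
      ∀ c ∈ KZ.relations, twist P c ∈ KZ.relations := by
  sorry

/-- **STUB S4 — ONE MORE TWIST KEEPS A SPHERICAL REPRESENTATION SPHERICAL** — by name the route's
support item `TwistStable` (stmt-KontsevichZagierPeriods-16459; M; `twistStable_iff` spells it in this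
file's vocabulary): for pinned `P` and spherical `R` of dimension `2m` there is a spherical `R′` of
dimension `2(m+1)` with `[P R] − [R′] ∈ relations` (the front disc becomes a new sphere by the radial
change of variables `w ↦ w/√(1+|w|²)`, planes shift by one). Why it might fail: it should not (the
`finProdFinEquiv` plane layout may force one extra coordinate permutation, itself a move).
[cite: KontsevichZagier2001, §1.2] -/
theorem stub_twistStable : TwistStable := by
  sorry

/-! ### Consistency: each named statement IS its registered stub (definitionally) -/

theorem cubeNormalForm_holds : CubeNormalForm := stub_cubeNormalForm
theorem cubeSpin_holds : CubeSpin := stub_cubeSpin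
theorem twistIdeal_holds : TwistIdeal := stub_twistIdeal

/-! ### Name-keyed aliases of the four statements — the hypotheses of `SpinNormalForm_of`

The native skeleton audit (`#h21_check_skeleton`) admits a hypothesis of a skeleton theorem only if its
head constant is a registered obligation or is NAMED like a declared stub; `__Registered.stub_X` is the
statement of `stub_X` under that name (device of `Cruxes/BoundedCost/Lines/birth.lean`). Each alias is
`rfl`-equal to its statement. -/
namespace __Registered

/-- Alias of `CubeNormalForm` keyed by the registered stub name. -/
abbrev stub_cubeNormalForm : Prop := CubeNormalForm
/-- Alias of `CubeSpin` keyed by the registered stub name. -/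
abbrev stub_cubeSpin : Prop := CubeSpin
/-- Alias of `TwistIdeal` keyed by the registered stub name. -/
abbrev stub_twistIdeal : Prop := TwistIdeal
/-- Alias of the route item `TwistStable` keyed by the registered stub name. -/
abbrev stub_twistStable : Prop := TwistStable

end __Registered

/-! ### Glue (sorry-free): spherical representations of a fixed dimension merge -/

/-- The zero density on `ℝ^{2m}` is a spherical representation and a relation (`[ℝ^{2m}, 0] =
[ℝ^{2m}, 0] + [ℝ^{2m}, 0]` by integrand additivity). [cite: KontsevichZagier2001, §1.2] -/
theorem exists_sph_zero (m : ℕ) :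
    ∃ R₀ : KZ.IntegralRep (m * 2), Sph m R₀ ∧ KZ.of R₀ ∈ KZ.relations := by
  have hq : ∀ x ∈ (Set.univ : Set (Fin (m * 2) → ℝ)),
      MvPolynomial.aeval x (1 : MvPolynomial (Fin (m * 2)) ℚ) ≠ 0 := by
    intro x _
    simp
  have hint : IntegrableOn (fun x : Fin (m * 2) → ℝ =>
      MvPolynomial.aeval x (0 : MvPolynomial (Fin (m * 2)) ℚ) /
        MvPolynomial.aeval x (1 : MvPolynomial (Fin (m * 2)) ℚ)) Set.univ := by
    simp
  obtain ⟨R₀, hd, hi⟩ : ∃ R₀ : KZ.IntegralRep (m * 2), R₀.domain = Set.univ ∧ ∀ x, R₀.integrand x = 0 :=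
    ⟨KZ.IntegralRep.ofRational Set.univ 0 1
      Literature.ModelTheory.ExponentialFields.isSemialgebraic_univ hq hint, rfl, fun x => by simp⟩
  refine ⟨R₀, ⟨hd, fun ε => ⟨fun _ => 0, fun _ => analyticAt_const, fun w _ => by rw [hi, zero_mul]⟩⟩, ?_⟩
  have hmem : KZ.of R₀ - KZ.of R₀ - KZ.of R₀ ∈ KZ.relations :=
    KZ.integrandAddRel_subset_relations ⟨m * 2, R₀, R₀, R₀, rfl, rfl, fun x _ => by simp [hi], rfl⟩
  simpa using hmem

/-- Two spherical representations of the same dimension add to one: `[ℝ^{2m}, f₁] + [ℝ^{2m}, f₂] ≡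
[ℝ^{2m}, f₁ + f₂]` (one integrand-additivity move; the chart densities add).
[cite: KontsevichZagier2001, §1.2] [cite: BochnakCosteRoy1998, Prop. 2.2.6] -/
theorem exists_sph_add {m : ℕ} {R₁ R₂ : KZ.IntegralRep (m * 2)} (h₁ : Sph m R₁) (h₂ : Sph m R₂) :
    ∃ R : KZ.IntegralRep (m * 2), Sph m R ∧ KZ.of R₁ + KZ.of R₂ - KZ.of R ∈ KZ.relations := by
  obtain ⟨hd₁, hK₁⟩ := h₁
  obtain ⟨hd₂, hK₂⟩ := h₂
  have hsa : IsSemialgebraicFunOn ℚ (Set.univ : Set (Fin (m * 2) → ℝ))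
      (R₁.integrand + R₂.integrand) := by
    have a := R₁.isSemialgebraicFunOn_integrand
    have b := R₂.isSemialgebraicFunOn_integrand
    rw [hd₁] at a
    rw [hd₂] at b
    exact IsSemialgebraicFunOn.add_holds a b
  have hint : IntegrableOn (R₁.integrand + R₂.integrand) (Set.univ : Set (Fin (m * 2) → ℝ)) := by
    have a := R₁.integrableOn
    have b := R₂.integrableOn
    rw [hd₁] at a
    rw [hd₂] at b
    exact a.add b
  obtain ⟨R, hRd, hRi⟩ : ∃ R : KZ.IntegralRep (m * 2),
      R.domain = Set.univ ∧ R.integrand = R₁.integrand + R₂.integrand :=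
    ⟨⟨Set.univ, R₁.integrand + R₂.integrand,
      Literature.ModelTheory.ExponentialFields.isSemialgebraic_univ, hsa, hint⟩, rfl, rfl⟩
  refine ⟨R, ⟨hRd, fun ε => ?_⟩, ?_⟩
  · obtain ⟨K₁, hK₁a, hK₁e⟩ := hK₁ ε
    obtain ⟨K₂, hK₂a, hK₂e⟩ := hK₂ ε
    refine ⟨fun w => K₁ w + K₂ w, fun w => (hK₁a w).add (hK₂a w), fun w hw => ?_⟩
    show K₁ w + K₂ w = _
    rw [hK₁e w hw, hK₂e w hw, hRi, Pi.add_apply]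
    ring
  · have hmem : KZ.of R - KZ.of R₁ - KZ.of R₂ ∈ KZ.relations :=
      KZ.integrandAddRel_subset_relations
        ⟨m * 2, R, R₁, R₂, hd₁.trans hRd.symm, hd₂.trans hRd.symm, fun x _ => by rw [hRi], rfl⟩
    have : KZ.of R₁ + KZ.of R₂ - KZ.of R = -(KZ.of R - KZ.of R₁ - KZ.of R₂) := by abel
    rw [this]
    exact KZ.relations.neg_mem hmem

/-- Finite sums of spherical representations of one dimension merge to one (induction on the sum).
[cite: KontsevichZagier2001, §1.2] -/
theorem exists_sph_sum (m : ℕ) {ι : Type*} (s : Finset ι) (R : ι → KZ.IntegralRep (m * 2))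
    (hR : ∀ j ∈ s, Sph m (R j)) :
    ∃ R₀ : KZ.IntegralRep (m * 2), Sph m R₀ ∧ ∑ j ∈ s, KZ.of (R j) - KZ.of R₀ ∈ KZ.relations := by
  classical
  induction s using Finset.induction_on with
  | empty =>
    obtain ⟨R₀, h₀, hrel⟩ := exists_sph_zero m
    exact ⟨R₀, h₀, by simpa using hrel⟩
  | @insert a s ha ih =>
    obtain ⟨R₁, h₁, hrel₁⟩ := ih (fun j hj => hR j (Finset.mem_insert_of_mem hj))
    obtain ⟨R₂, h₂, hrel₂⟩ := exists_sph_add (hR a (Finset.mem_insert_self a s)) h₁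
    refine ⟨R₂, h₂, ?_⟩
    rw [Finset.sum_insert ha]
    have : KZ.of (R a) + ∑ j ∈ s, KZ.of (R j) - KZ.of R₂ =
        (∑ j ∈ s, KZ.of (R j) - KZ.of R₁) + (KZ.of (R a) + KZ.of R₁ - KZ.of R₂) := by abel
    rw [this]
    exact KZ.relations.add_mem hrel₁ hrel₂

/-! ### The composition (sorry-free) -/

/-- **Skeleton theorem, arrow form** (concludes the crux BY NAME; type
`stub_cubeNormalForm-sig → stub_cubeSpin-sig → stub_twistIdeal-sig → stub_twistStable-sig →
SpinNormalForm`, the hypotheses spelled through the name-keyed aliases): for a pinned `P` and `r` of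
dimension `n`, decompose `[r] ≡ Σ_j [ρ_j]` into good cubes (S1), push the decomposition through `κⁿ`
(S3), spin each cube into a spherical `[R_j]` of dimension `2n` (S2), merge `Σ_j [R_j] ≡ [R₀]`
(`exists_sph_sum`): `N₀ = n`; then climb `N = n + j` by S4 and S3. [cite: KontsevichZagier2001, §1.2] -/
theorem SpinNormalForm_of (h₁ : __Registered.stub_cubeNormalForm) (h₂ : __Registered.stub_cubeSpin)
    (h₃ : __Registered.stub_twistIdeal) (h₄ : __Registered.stub_twistStable) :
    SpinNormalForm := by
  rw [spinNormalForm_iff]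
  intro P hP n r
  -- iterates of the twist: preserve relations, commute with `−` and finite sums
  have T_rel : ∀ (k : ℕ) (c : KZ.FormalRep), c ∈ KZ.relations →
      (⇑(twist P))^[k] c ∈ KZ.relations := by
    intro k
    induction k with
    | zero => intro c hc; simpa using hc
    | succ k ih =>
      intro c hc
      rw [Function.iterate_succ_apply']
      exact h₃ P hP _ (ih c hc)
  have T_sub : ∀ (k : ℕ) (a b : KZ.FormalRep),
      (⇑(twist P))^[k] (a - b) = (⇑(twist P))^[k] a - (⇑(twist P))^[k] b := by
    intro k
    induction k with
    | zero => intro a b; rfl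
    | succ k ih =>
      intro a b
      rw [Function.iterate_succ_apply', Function.iterate_succ_apply', Function.iterate_succ_apply',
        ih, map_sub]
  have T_sum : ∀ (k : ℕ) {ι : Type} (s : Finset ι) (f : ι → KZ.FormalRep),
      (⇑(twist P))^[k] (∑ j ∈ s, f j) = ∑ j ∈ s, (⇑(twist P))^[k] (f j) := by
    intro k
    induction k with
    | zero => intro ι s f; simp only [Function.iterate_zero, id_eq]
    | succ k ih =>
      intro ι s f
      simp only [Function.iterate_succ_apply', ih, map_sum]
  -- (1) cube normal form, (2) spin each cube, merge on the common domain `ℝ^{2n}`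
  obtain ⟨k, ρ, hρ, hdec⟩ := h₁ n r
  choose R hR hTR using fun j : Fin k => h₂ P hP n (ρ j) (hρ j)
  obtain ⟨R₀, hR₀, hsum⟩ := exists_sph_sum n Finset.univ R (fun j _ => hR j)
  have base : (⇑(twist P))^[n] (KZ.of r) - KZ.of R₀ ∈ KZ.relations := by
    have ha : (⇑(twist P))^[n] (KZ.of r) - ∑ j, (⇑(twist P))^[n] (KZ.of (ρ j)) ∈ KZ.relations := by
      have := T_rel n _ hdec
      rwa [T_sub, T_sum] at this
    have hb : ∑ j, (⇑(twist P))^[n] (KZ.of (ρ j)) - ∑ j, KZ.of (R j) ∈ KZ.relations := by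
      rw [← Finset.sum_sub_distrib]
      exact sum_mem fun j _ => hTR j
    have h := KZ.relations.add_mem (KZ.relations.add_mem ha hb) hsum
    convert h using 1
    abel
  -- (3) climb from `N₀ = n` with TwistStable and the twist ideal
  have step : ∀ j : ℕ, ∃ (m : ℕ) (S : KZ.IntegralRep (m * 2)), Sph m S ∧
      (⇑(twist P))^[n + j] (KZ.of r) - KZ.of S ∈ KZ.relations := by
    intro j
    induction j with
    | zero => exact ⟨n, R₀, hR₀, base⟩
    | succ j ih =>
      obtain ⟨m, S, hS, hTS⟩ := ih
      obtain ⟨S', hS', hPS⟩ := (twistStable_iff.mp h₄) P hP m S hS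
      refine ⟨m + 1, S', hS', ?_⟩
      have h1 : twist P ((⇑(twist P))^[n + j] (KZ.of r) - KZ.of S) ∈ KZ.relations := h₃ P hP _ hTS
      rw [map_sub, twist_of] at h1
      rw [← add_assoc, Function.iterate_succ_apply']
      have h := KZ.relations.add_mem h1 hPS
      convert h using 1
      abel
  refine ⟨n, fun N hN => ?_⟩
  obtain ⟨j, rfl⟩ := Nat.exists_eq_add_of_le hN
  exact step j

/-- **Skeleton theorem, by name**: `SpinNormalForm` from the four registered stubs (its only `sorryAx`
dependencies are `stub_cubeNormalForm`, `stub_cubeSpin`, `stub_twistIdeal`, `stub_twistStable`).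
[cite: KontsevichZagier2001, §1.2] -/
theorem SpinNormalForm_skeleton : SpinNormalForm :=
  SpinNormalForm_of stub_cubeNormalForm stub_cubeSpin stub_twistIdeal stub_twistStable

end Summit.KontsevichZagierPeriods.KontsevichZagierPeriods.Cruxes.SpinNormalForm.Birth
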